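/-
COR-CM (cell pub-hodgecm2, stage 2 of the Hodge ladder) — count-neutral KERNEL COMBINATORICS «face characters read in the group:
base change, Galois twists, type squares, orbits» (seat prover-pub-hodgecm2-b23-g31-0, binder prover b23, gen 31; claim INT2-ORBIT,
HOME/lit/LIT-STATUS.md 2026-08-21T14:03:32Z; sequel of `CorCM/FacePeriodsGeneratingSet.lean`, p274957).  Pure CM-type
combinatorics over the ported `CM/LefschetzChar1/2.lean` ([QW8] §2–3) and `Prior/AllgGroup*.lean` (rfwf `l:allg`); no geometry,
no `Universe`, no definition, no named fact, nothing asserted.  Seat b06's `Face.twist` (`CorCM/CMTwistSemilinear.lean`), seat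
b07's flip lemmas and same-square hypothesis shape (`CorCM/FaceSquareSymmetry.lean`) and own-b01's `Face.flip_bar` /
`Face.cmTypeMap_bar` (`CorCM/B01/InducedPeriodType.lean`) are used BY NAME; nothing of theirs is restated; `Interfaces.lean` (C1),
every E term, B01 and `Transposition/*` are untouched.
HONEST FRAMING (COORDINATOR RULING — HODGE FRAMING CORRECTION, 2026-08-21T11:55:35Z): `HC_CM` is NOT proved, here or anywhere in
the tree; this file proves no face period and no generation statement for any particular field.
-/
import Summits.HodgeConjecture.CorCM.CMTwistSemilinear
import Summits.HodgeConjecture.CorCM.B01.InducedPeriodType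
import Summits.HodgeConjecture.CorCM.CM.LefschetzChar2
import HarnessLib

/-!
# Face characters read in the group: base change, Galois twists, type squares — the generation binder of INT-2 by orbits

The generating-set form of the face reduction (`Universe.hc_cmProd_of_faceSet`, `CorCM/FacePeriodsGeneratingSet.lean`) carries
ONE combinatorial binder,

  `hgen : ∀ f : Face F, lefChar f.corner (fun _ => {σ₀}) ∈ AddSubgroup.closure {lefChar g.corner (fun _ => {σ}) | g ∈ 𝒮, σ}`

— the `σ₀`-Weil characters of ALL rank-four faces of the Galois CM field `F` lie in the subgroup of `Asym F` generated by the
Weil characters, at all base embeddings `σ`, of the faces of the chosen set `𝒮`.  This file computes these characters and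
discharges `hgen` in the two shapes the degree-by-degree lane meets:

* §1 `lefChar_corner_eq` — the `σ`-character of the corner product of `f = (Φ; π, π′)` is the alternating square sum
  `ā[Φ] − ā[Φ^{(π)}] − ā[Φ^{(π′)}] + ā[Φ^{(ππ′)}]` read at `σ` ("ā kills pairs": the two conjugated corners enter with a sign);
  `lefChar_corner_eq_abar_gface` — equivalently `ā` of the GROUP-LEVEL face relation `gface` of rfwf `l:allg` read along `σ`
  (`CM/LefschetzChar2.lean` has this for the faces `faceOfG` built from group data; here for an arbitrary face).
* §2 `lefChar_corner_twist` — a Galois twist of the face is a change of base embedding: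
  `lefChar (f.twist g).corner (fun _ => {σ}) = lefChar f.corner (fun _ => {σ ∘ g})`.
* §3 `lefChar_corner_of_sameSquare` — two faces with the same type square (seat b07's hypotheses `hpl`/`hΦ` of
  `Universe.periodNV_iff_of_sameSquare`, verbatim) have the same `σ`-character up to sign.
* §4 `lefChar_corner_mem_closure_of_squareOrbits` — **`hgen` DISCHARGED BY ORBITS**: if every face of `F` shares its type
  square with a Galois twist of a face of `𝒮` (one representative per `Aut(F)`-orbit of type squares suffices: seat b30's
  census counts `3·4·4·6·5·3` such orbits for the six Galois types of degree `8`), then `hgen` holds at EVERY base embedding `σ₀`.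
  This is the CHARACTER-level counterpart of seat b06's `Model.periodNV_face_twist` / seat b07's `periodNV_iff_of_sameSquare`:
  no period is transported, no hermitian space is relabelled, and it holds verbatim on any universe with the [QW8] steps.
* §5 `lefChar_corner_mem_closure_of_ker_le` — **CERTIFICATE INTERFACE**: `hgen` follows from the purely group-level
  inclusion `ker (typeSum) ≤ span ℤ {gface-reads of 𝒮 at all σ} ⊔ pairRel` in `ℤ[types of (E, c)]` (`E = GalT F`), i.e. from
  "the face relations of `𝒮` and their translates, together with the pairs `[Ψ] + [Ψ̄]`, generate the relation lattice
  `R_F = ker(ℤ[types] → ℤ[E])`" — the statement a finite certificate has to establish for a generating set SMALLER than a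
  system of orbit representatives (b30: `1·2·2·3·2·2` at degree `8`).

References: [QW8] Def. 2.3 / Thm 2.5 and rfwf v3 §8 `l:allg` (the cell's 2001 sources, kernel: `CM/LefschetzChar*`,
`Prior/AllgGroup*`); [cite: Milne1999LefschetzClasses, Thm. 3.2]; [cite: Pohlmann1968, Thm. 1].
-/

noncomputable section

open NumberField NumberField.ComplexEmbedding

namespace Summit.HodgeConjecture.CorCM

open Literature.AlgebraicGeometry.Motives (CMType)
open Literature.NumberTheory.ComplexMultiplication.CMTypeOps
open Literature.NumberTheory.Automorphic.PicardCM.CMCode (cmTypeMap mem_cmTypeMap_iff)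
open Summit.HodgeConjecture.CorCM.Prior.AllgGroup.RfwfAllgGroup

variable {F : Type} [Field F] [NumberField F]

/-! ## §1 The `σ`-character of the corner product of a face -/

/-- **The `σ`-Weil character of the corner product of a face, expanded.**  For `f = (Φ; π, π′)` with corners
`(Φ, Φ̄^{(π)}, Φ̄^{(π′)}, Φ^{(ππ′)})` and the weight "eigencharacter `σ` on each corner":
`a = ā[Φ]_σ − ā[Φ^{(π)}]_σ − ā[Φ^{(π′)}]_σ + ā[Φ^{(ππ′)}]_σ`, where `ā[Θ]_σ = achar (pullType Θ σ)` — the conjugated corners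
contribute with a minus sign because `ā` kills pairs ([QW8] §3, combinatorial half). [cite: Milne1999LefschetzClasses, Thm. 3.2] -/
theorem lefChar_corner_eq (f : Face F) (σ : F →+* ℂ) :
    lefChar f.corner (fun _ => ({σ} : Finset (F →+* ℂ))) =
      achar (pullType f.Φ σ) - achar (pullType (flip f.p f.Φ) σ) - achar (pullType (flip f.p' f.Φ) σ)
        + achar (pullType (flip f.p' (flip f.p f.Φ)) σ) := by
  unfold lefChar
  rw [Fin.sum_univ_four]
  simp only [Finset.sum_singleton]
  change achar (pullType f.Φ σ) + achar (pullType (flip f.p (bar f.Φ)) σ) +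
      achar (pullType (flip f.p' (bar f.Φ)) σ) + achar (pullType (flip f.p' (flip f.p f.Φ)) σ) = _
  rw [Face.flip_bar, Face.flip_bar, pullType_bar, pullType_bar, achar_bar, achar_bar]
  abel

/-- Pulling back a flipped type along `σ` is the abstract flip, at the translate carrying `σ` to the flipping place, of the
pulled-back type (`pullType_flip` of `CM/LefschetzChar2.lean` with the translate made explicit). [folklore] -/
theorem pullType_flip_translate [IsGalois ℚ F] (Θ : CMType F) (σ p : F →+* ℂ) :
    pullType (flip p Θ) σ = oflipCM conjT conjT_mul_self (translate σ p) (pullType Θ σ) := by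
  have h := pullType_flip Θ σ (translate σ p)
  rwa [translate_apply_self] at h

/-- For a face `f` and a base embedding `σ`, the translate carrying `σ` to `π′` is off the place `{t, c·t}` of the translate
`t` carrying `σ` to `π` (the two places of a face are distinct). [folklore] -/
theorem Face.translate_notMem_orb [IsGalois ℚ F] (f : Face F) (σ : F →+* ℂ) :
    translate σ f.p' ∉ orb conjT (translate σ f.p) := by
  intro h
  rw [mem_orb] at h
  apply f.place_ne
  rw [InfinitePlace.mk_eq_iff]
  rcases h with h | h
  · left
    have e := congrArg (fun P : GalT F => P.1 σ) h
    simp only [translate_apply_self] at e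
    exact e.symm
  · right
    have e := congrArg (fun P : GalT F => P.1 σ) h
    simp only [translate_apply_self, GalT.mul_apply, conjT_apply] at e
    exact e.symm

/-- **Dictionary, arbitrary face.**  The `σ`-Weil character of the corner product of ANY face `f = (Φ; π, π′)` of a Galois
CM field is `ā` of the group-level face relation `[Φ′] + [Φ′^{(tt′)}] − [Φ′^{(t)}] − [Φ′^{(t′)}]` (rfwf `l:allg`, `gface`) of the
type `Φ′ = Φ` read along `σ` at the translates `t, t′` carrying `σ` to `π, π′` (`CM/LefschetzChar2.lean` proves this for the
faces `faceOfG σ Φ′ t t′` manufactured from group data; every face is of that form). [cite: Milne1999LefschetzClasses, Thm. 3.2] -/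
theorem lefChar_corner_eq_abar_gface [IsGalois ℚ F] (f : Face F) (σ : F →+* ℂ) :
    lefChar f.corner (fun _ => ({σ} : Finset (F →+* ℂ))) =
      abar (gface conjT conjT_mul_self (pullType f.Φ σ) (translate σ f.p) (translate σ f.p')) := by
  rw [lefChar_corner_eq]
  simp only [pullType_flip_translate]
  rw [oflipCM_comm (translate σ f.p') (translate σ f.p), gface, map_sub, map_sub, map_add]
  simp only [achar]
  abel

/-! ## §2 Galois twists are changes of the base embedding -/

/-- A Galois translate commutes with precomposition by a RING automorphism of `F` (every ring automorphism of a number field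
is `ℚ`-linear). [folklore] -/
theorem GalT.apply_comp_ringEquiv (P : GalT F) (σ : F →+* ℂ) (g : F ≃+* F) :
    P.1 (σ.comp g.toRingHom) = (P.1 σ).comp g.toRingHom := by
  have hg : ∀ q : ℚ, g (algebraMap ℚ F q) = algebraMap ℚ F q := fun q => by
    rw [eq_ratCast (algebraMap ℚ F) q]
    exact map_ratCast g q
  have e : ((AlgEquiv.ofRingEquiv (f := g) hg : F ≃ₐ[ℚ] F) : F →+* F) = g.toRingHom := RingHom.ext fun _ => rfl
  have h := P.2 σ (AlgEquiv.ofRingEquiv (f := g) hg)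
  rwa [e] at h

/-- Pulling back a TWISTED type along `σ` is pulling back the type along `σ ∘ g`. [folklore] -/
theorem pullType_cmTypeMap (g : F ≃+* F) (Θ : CMType F) (σ : F →+* ℂ) :
    pullType (cmTypeMap g Θ) σ = pullType Θ (σ.comp g.toRingHom) := by
  apply Subtype.ext
  ext P
  rw [mem_pullType, mem_pullType, mem_cmTypeMap_iff, GalT.apply_comp_ringEquiv]

/-- **A Galois twist of a face is a change of base embedding for its Weil characters:**
`lefChar (g·f).corner (fun _ => {σ}) = lefChar f.corner (fun _ => {σ ∘ g})` (`Face.twist`: `g·(Φ; π, π′) = (Φ^g; gπ, gπ′)`).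
So in the generation binder `hgen`, which already ranges over all base embeddings of the faces of `𝒮`, Galois-twisted copies of
a face of `𝒮` are free. [cite: Milne1999LefschetzClasses, Thm. 3.2] -/
theorem lefChar_corner_twist (f : Face F) (g : F ≃+* F) (σ : F →+* ℂ) :
    lefChar (f.twist g).corner (fun _ => ({σ} : Finset (F →+* ℂ))) =
      lefChar f.corner (fun _ => ({σ.comp g.toRingHom} : Finset (F →+* ℂ))) := by
  rw [lefChar_corner_eq, lefChar_corner_eq]
  change achar (pullType (cmTypeMap g f.Φ) σ)
      - achar (pullType (flip (f.p.comp g.symm.toRingHom) (cmTypeMap g f.Φ)) σ)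
      - achar (pullType (flip (f.p'.comp g.symm.toRingHom) (cmTypeMap g f.Φ)) σ)
      + achar (pullType (flip (f.p'.comp g.symm.toRingHom) (flip (f.p.comp g.symm.toRingHom) (cmTypeMap g f.Φ))) σ) = _
  simp only [← Face.cmTypeMap_flip, pullType_cmTypeMap]

/-! ## §3 The character depends on the type square only, up to sign -/

/-- Exchanging the two places does not change the alternating square sum. [folklore] -/
theorem squareChar_swap (Ψ : CMType F) (p p' σ : F →+* ℂ) :
    achar (pullType Ψ σ) - achar (pullType (flip p' Ψ) σ) - achar (pullType (flip p Ψ) σ)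
        + achar (pullType (flip p (flip p' Ψ)) σ) =
      achar (pullType Ψ σ) - achar (pullType (flip p Ψ) σ) - achar (pullType (flip p' Ψ) σ)
        + achar (pullType (flip p' (flip p Ψ)) σ) := by
  rw [flip_comm p p' Ψ]
  abel

/-- Moving the base type around the square `{Φ, Φ^{(π)}, Φ^{(π′)}, Φ^{(ππ′)}}` changes the alternating square sum at most by a
sign: `+` on the diagonal `{Φ, Φ^{(ππ′)}}`, `−` on the other one. [folklore] -/
theorem squareChar_of_mem_square (Φ : CMType F) (p p' σ : F →+* ℂ) {Ψ : CMType F}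
    (hΨ : Ψ = Φ ∨ Ψ = flip p Φ ∨ Ψ = flip p' Φ ∨ Ψ = flip p' (flip p Φ)) :
    achar (pullType Ψ σ) - achar (pullType (flip p Ψ) σ) - achar (pullType (flip p' Ψ) σ)
          + achar (pullType (flip p' (flip p Ψ)) σ) =
        achar (pullType Φ σ) - achar (pullType (flip p Φ) σ) - achar (pullType (flip p' Φ) σ)
          + achar (pullType (flip p' (flip p Φ)) σ) ∨
      achar (pullType Ψ σ) - achar (pullType (flip p Ψ) σ) - achar (pullType (flip p' Ψ) σ)
          + achar (pullType (flip p' (flip p Ψ)) σ) =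
        -(achar (pullType Φ σ) - achar (pullType (flip p Φ) σ) - achar (pullType (flip p' Φ) σ)
          + achar (pullType (flip p' (flip p Φ)) σ)) := by
  rcases hΨ with rfl | rfl | rfl | rfl
  · exact Or.inl rfl
  · right
    rw [flip_flip p Φ]
    abel
  · right
    rw [flip_comm p p' Φ, flip_flip p' Φ, flip_flip p' (flip p Φ)]
    abel
  · left
    rw [flip_comm p p' (flip p Φ), flip_flip p Φ, flip_flip p' (flip p Φ), flip_flip p' Φ]
    abel

/-- **Faces with the same type square have the same Weil characters up to sign.**  Hypotheses VERBATIM those of seat b07's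
`Universe.periodNV_iff_of_sameSquare` (`CorCM/FaceSquareSymmetry.lean`): `f′` has the unordered pair of places of `f` and its base
type is one of the four corners `Φ, Φ^{(π)}, Φ^{(π′)}, Φ^{(ππ′)}` of the square of `f`.  Then for every base embedding `σ` the
`σ`-Weil character of the corner product of `f′` is `±` that of `f` (so both generate the same subgroup of `Asym F`).
[cite: Milne1999LefschetzClasses, Thm. 3.2] -/
theorem lefChar_corner_of_sameSquare {f f' : Face F}
    (hpl : (InfinitePlace.mk f'.p = InfinitePlace.mk f.p ∧ InfinitePlace.mk f'.p' = InfinitePlace.mk f.p') ∨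
      (InfinitePlace.mk f'.p = InfinitePlace.mk f.p' ∧ InfinitePlace.mk f'.p' = InfinitePlace.mk f.p))
    (hΦ : f'.Φ = f.Φ ∨ f'.Φ = flip f.p f.Φ ∨ f'.Φ = flip f.p' f.Φ ∨ f'.Φ = flip f.p' (flip f.p f.Φ)) (σ : F →+* ℂ) :
    lefChar f'.corner (fun _ => ({σ} : Finset (F →+* ℂ))) = lefChar f.corner (fun _ => ({σ} : Finset (F →+* ℂ))) ∨
      lefChar f'.corner (fun _ => ({σ} : Finset (F →+* ℂ))) = -lefChar f.corner (fun _ => ({σ} : Finset (F →+* ℂ))) := by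
  rw [lefChar_corner_eq, lefChar_corner_eq]
  rcases hpl with ⟨hp, hp'⟩ | ⟨hp, hp'⟩
  · have e1 : (flip f'.p : CMType F → CMType F) = flip f.p := funext fun Θ => flip_eq_of_mk_eq hp Θ
    have e2 : (flip f'.p' : CMType F → CMType F) = flip f.p' := funext fun Θ => flip_eq_of_mk_eq hp' Θ
    rw [e1, e2]
    exact squareChar_of_mem_square f.Φ f.p f.p' σ hΦ
  · have e1 : (flip f'.p : CMType F → CMType F) = flip f.p' := funext fun Θ => flip_eq_of_mk_eq hp Θ
    have e2 : (flip f'.p' : CMType F → CMType F) = flip f.p := funext fun Θ => flip_eq_of_mk_eq hp' Θ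
    rw [e1, e2, squareChar_swap]
    exact squareChar_of_mem_square f.Φ f.p f.p' σ hΦ

/-! ## §4 The generation binder `hgen` discharged by orbits of type squares -/

/-- **`hgen` FROM ONE FACE PER ORBIT OF TYPE SQUARES.**  Let `𝒮` be a set of faces of `F` such that every face `f` of `F`
shares its type square (seat b07's `hpl`/`hΦ`) with a Galois twist `g·τ` (`Face.twist`) of some `g ∈ 𝒮` — e.g. `𝒮` contains one
face from each `Aut(F)`-orbit of type squares.  Then for EVERY base embedding `σ₀` and every face `f`, the `σ₀`-Weil character
of the corner product of `f` lies in the subgroup of `Asym F` generated by the Weil characters of the faces of `𝒮` at all base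
embeddings: the binder `hgen` of `Universe.hc_cmProd_of_faceSet` (`CorCM/FacePeriodsGeneratingSet.lean`) holds.
(By §2 the twist is the base change `σ₀ ↦ σ₀ ∘ τ`; by §3 the square mate has `±` the same character.)
[cite: Milne1999LefschetzClasses, Thm. 3.2] [cite: Pohlmann1968, Thm. 1] -/
theorem lefChar_corner_mem_closure_of_squareOrbits (𝒮 : Set (Face F))
    (hrep : ∀ f : Face F, ∃ g ∈ 𝒮, ∃ τ : F ≃+* F,
      ((InfinitePlace.mk f.p = InfinitePlace.mk (g.twist τ).p ∧ InfinitePlace.mk f.p' = InfinitePlace.mk (g.twist τ).p') ∨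
        (InfinitePlace.mk f.p = InfinitePlace.mk (g.twist τ).p' ∧ InfinitePlace.mk f.p' = InfinitePlace.mk (g.twist τ).p)) ∧
      (f.Φ = (g.twist τ).Φ ∨ f.Φ = flip (g.twist τ).p (g.twist τ).Φ ∨ f.Φ = flip (g.twist τ).p' (g.twist τ).Φ ∨
        f.Φ = flip (g.twist τ).p' (flip (g.twist τ).p (g.twist τ).Φ)))
    (σ₀ : F →+* ℂ) (f : Face F) :
    lefChar f.corner (fun _ => ({σ₀} : Finset (F →+* ℂ))) ∈ AddSubgroup.closure
      {a : Asym F | ∃ g ∈ 𝒮, ∃ σ : F →+* ℂ, a = lefChar g.corner (fun _ => ({σ} : Finset (F →+* ℂ)))} := by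
  obtain ⟨g, hg, τ, hpl, hΦ⟩ := hrep f
  have hmem : lefChar (g.twist τ).corner (fun _ => ({σ₀} : Finset (F →+* ℂ))) ∈ AddSubgroup.closure
      {a : Asym F | ∃ g ∈ 𝒮, ∃ σ : F →+* ℂ, a = lefChar g.corner (fun _ => ({σ} : Finset (F →+* ℂ)))} := by
    rw [lefChar_corner_twist]
    exact AddSubgroup.subset_closure ⟨g, hg, _, rfl⟩
  rcases lefChar_corner_of_sameSquare hpl hΦ σ₀ with h | h
  · rw [h]; exact hmem
  · rw [h]; exact AddSubgroup.neg_mem _ hmem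

omit [NumberField F] in
/-- **Sanity (`𝒮 ∋` every face up to twist-and-square is implied by `𝒮 = univ`):** with `𝒮 = Set.univ` the orbit hypothesis holds
with `τ = 1`, so §4 specialises to the trivial generation of `CorCM/FacePeriodsGeneratingSet.lean`
(`Universe.faceReduction_of_faceSet_univ`). [folklore] -/
theorem squareOrbits_univ (f : Face F) : ∃ g ∈ (Set.univ : Set (Face F)), ∃ τ : F ≃+* F,
    ((InfinitePlace.mk f.p = InfinitePlace.mk (g.twist τ).p ∧ InfinitePlace.mk f.p' = InfinitePlace.mk (g.twist τ).p') ∨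
      (InfinitePlace.mk f.p = InfinitePlace.mk (g.twist τ).p' ∧ InfinitePlace.mk f.p' = InfinitePlace.mk (g.twist τ).p)) ∧
    (f.Φ = (g.twist τ).Φ ∨ f.Φ = flip (g.twist τ).p (g.twist τ).Φ ∨ f.Φ = flip (g.twist τ).p' (g.twist τ).Φ ∨
      f.Φ = flip (g.twist τ).p' (flip (g.twist τ).p (g.twist τ).Φ)) := by
  refine ⟨f, Set.mem_univ f, RingEquiv.refl F, Or.inl ⟨?_, ?_⟩, Or.inl ?_⟩
  · rfl
  · rfl
  · apply Subtype.ext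
    ext ψ
    change ψ ∈ f.Φ.1 ↔ ψ.comp (RingEquiv.refl F).toRingHom ∈ f.Φ.1
    rw [show ψ.comp (RingEquiv.refl F).toRingHom = ψ from RingHom.ext fun _ => rfl]

/-! ## §5 Certificate interface: generation of the relation lattice modulo pairs -/

/-- **`hgen` FROM A GROUP-LEVEL GENERATION CERTIFICATE.**  In `ℤ[types of (E, c)]`, `E = GalT F`, let the face relations of
the faces of `𝒮` read at all base embeddings (`gface (pullType g.Φ σ) (translate σ g.p) (translate σ g.p′)`, `g ∈ 𝒮`, `σ` arbitrary
— i.e. the `E`-translates of the face relations of `𝒮`), together with the pair relations `[Ψ] + [Ψ̄]` (`pairRel`), span a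
submodule containing the relation lattice `R_F = ker(ℤ[types] → ℤ[E])` (`typeSum`; by rfwf `l:allg`, `gfaces_generate`, `R_F` is
spanned by ALL face relations).  Then `hgen` holds at every base embedding `σ₀`: every face relation lies in `R_F`
(`typeSum_gface`), `ā` kills `pairRel`, and `ā` of a read face relation is the corresponding Weil character (§1).  This is the
statement a finite generation certificate over a Galois type `(E, c)` has to deliver. [cite: Pohlmann1968, Thm. 1]
[cite: Milne1999LefschetzClasses, Thm. 3.2] -/
theorem lefChar_corner_mem_closure_of_ker_le [IsGalois ℚ F] (𝒮 : Set (Face F))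
    (hspan : LinearMap.ker (typeSum (GalT F) conjT) ≤
      Submodule.span ℤ {y : CMF (GalT F) conjT →₀ ℤ | ∃ g ∈ 𝒮, ∃ σ : F →+* ℂ,
          y = gface conjT conjT_mul_self (pullType g.Φ σ) (translate σ g.p) (translate σ g.p')} ⊔ pairRel)
    (σ₀ : F →+* ℂ) (f : Face F) :
    lefChar f.corner (fun _ => ({σ₀} : Finset (F →+* ℂ))) ∈ AddSubgroup.closure
      {a : Asym F | ∃ g ∈ 𝒮, ∃ σ : F →+* ℂ, a = lefChar g.corner (fun _ => ({σ} : Finset (F →+* ℂ)))} := by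
  rw [lefChar_corner_eq_abar_gface]
  have hker : gface conjT conjT_mul_self (pullType f.Φ σ₀) (translate σ₀ f.p) (translate σ₀ f.p') ∈
      LinearMap.ker (typeSum (GalT F) conjT) :=
    LinearMap.mem_ker.mpr (typeSum_gface conjT conjT_mul_self _ (Face.translate_notMem_orb f σ₀))
  obtain ⟨y, hy, z, hz, hyz⟩ := Submodule.mem_sup.mp (hspan hker)
  have hz0 : abar z = 0 := (Submodule.Quotient.mk_eq_zero _).mpr hz
  rw [← hyz, map_add, hz0, add_zero]
  refine Submodule.span_induction (p := fun y _ => abar y ∈ AddSubgroup.closure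
      {a : Asym F | ∃ g ∈ 𝒮, ∃ σ : F →+* ℂ, a = lefChar g.corner (fun _ => ({σ} : Finset (F →+* ℂ)))}) ?_ ?_ ?_ ?_ hy
  · rintro _ ⟨g, hg, σ, rfl⟩
    rw [← lefChar_corner_eq_abar_gface]
    exact AddSubgroup.subset_closure ⟨g, hg, σ, rfl⟩
  · rw [map_zero]
    exact AddSubgroup.zero_mem _
  · intro a b _ _ ha hb
    rw [map_add]
    exact AddSubgroup.add_mem _ ha hb
  · intro n a _ ha
    rw [map_zsmul]
    exact AddSubgroup.zsmul_mem _ ha n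

/-- **Conversely, orbit representatives give the certificate trivially up to sign** — the bridge between §4 and §5 at the group
level: the face relation of any face read at `σ₀` is `±` a read of a face of `𝒮` whenever the orbit hypothesis of §4 holds, so it
lies in the span of the reads of `𝒮` (no pairs needed).  (Recorded so that census certificates may list orbit representatives and
sub-orbit generators in one format.) [folklore] -/
theorem gface_read_mem_span_of_squareOrbits [IsGalois ℚ F] (𝒮 : Set (Face F))
    (hrep : ∀ f : Face F, ∃ g ∈ 𝒮, ∃ τ : F ≃+* F,
      ((InfinitePlace.mk f.p = InfinitePlace.mk (g.twist τ).p ∧ InfinitePlace.mk f.p' = InfinitePlace.mk (g.twist τ).p') ∨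
        (InfinitePlace.mk f.p = InfinitePlace.mk (g.twist τ).p' ∧ InfinitePlace.mk f.p' = InfinitePlace.mk (g.twist τ).p)) ∧
      (f.Φ = (g.twist τ).Φ ∨ f.Φ = flip (g.twist τ).p (g.twist τ).Φ ∨ f.Φ = flip (g.twist τ).p' (g.twist τ).Φ ∨
        f.Φ = flip (g.twist τ).p' (flip (g.twist τ).p (g.twist τ).Φ)))
    (σ₀ : F →+* ℂ) (f : Face F) :
    abar (gface conjT conjT_mul_self (pullType f.Φ σ₀) (translate σ₀ f.p) (translate σ₀ f.p')) ∈ AddSubgroup.closure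
      {a : Asym F | ∃ g ∈ 𝒮, ∃ σ : F →+* ℂ,
        a = abar (gface conjT conjT_mul_self (pullType g.Φ σ) (translate σ g.p) (translate σ g.p'))} := by
  have hset : {a : Asym F | ∃ g ∈ 𝒮, ∃ σ : F →+* ℂ,
        a = abar (gface conjT conjT_mul_self (pullType g.Φ σ) (translate σ g.p) (translate σ g.p'))} =
      {a : Asym F | ∃ g ∈ 𝒮, ∃ σ : F →+* ℂ, a = lefChar g.corner (fun _ => ({σ} : Finset (F →+* ℂ)))} := by
    ext a
    simp only [Set.mem_setOf_eq, lefChar_corner_eq_abar_gface]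
  rw [hset, ← lefChar_corner_eq_abar_gface]
  exact lefChar_corner_mem_closure_of_squareOrbits 𝒮 hrep σ₀ f

end Summit.HodgeConjecture.CorCM

end
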